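import Summits.HodgeConjecture.HodgeConjecture.Theorems.SignSymmetricPowersMeridianPencil
import Summits.HodgeConjecture.HodgeConjecture.Theorems.SignSymmetricPowersMeridianMonodromy
import Summits.HodgeConjecture.HodgeConjecture.Theorems.SignSymmetricPowersMeridianSameComponent
import Literature.AlgebraicGeometry.HodgeTheory.MonomialSupportedHypersurfaceInvariantCycles
import HarnessLib

/-!
# K1-B piece LINK-G, part (A): pencil circles around one-nodal members with the same node have
# `Γ`-conjugate transports (route `SignSymmetricPowers`, item stmt-HodgeConjecture-19716)

Line `andre-zariski`, skeleton v12e (`f94dc4e163f9499d`); helper file for the registered stub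
`stub_signConfluenceLinkG` (LINK-G), landed `--supports stmt-HodgeConjecture-19716`.  It is the END-TO-END consumer of
the fact F-MC (`affineHypersurfaceComplement_meridian_isConj`: meridians of one irreducible component of an affine
hypersurface arrangement are conjugate in `π₁` of the complement) for the Π- and L-type centres of the K1-B line:

Setting: `π_M : 𝒴_M → S_M` the family of smooth `M`-supported degree-`d` hypersurfaces of `ℙⁿ⁺¹` (`familyM`), `Disc`
an equation of the discriminant (F-DISC-0), `D_M = killHom Disc` its restriction to the `M`-supported forms, written
`D_M = w · ∏ⱼ hⱼ^{eⱼ}` with `w` a unit, the `hⱼ` irreducible and `eⱼ ≥ 1` (ANY such list — e.g. the distinct prime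
factors of `SignSymmetricPowersGenFactors.exists_distinct_irreducible_factors`, or the prime factors with repetition and
all `eⱼ = 1`), F-DISC-1 (`discriminant_localBranches_nodal`) granted.

* §1 `exists_homeomorph_of_complement_eq` — the coefficient chart `S_M(ℂ) ≃ₜ affineHypersurfaceComplement h` for ANY
  list `h` with `{D_M ≠ 0} = {a | ∀ j, hⱼ(a) ≠ 0}` (package II stated it for the factor multiset only).
* §2 `complement_eq_of_factorization`, `exists_common_factor_of_node_at_pow` — packages I/VII read through the list
  `(hⱼ^{eⱼ})ⱼ`: at a one-nodal `M`-form exactly one `hⱼ₀` vanishes, with `eⱼ₀ = 1`, transversally to every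
  co-pencil direction `g` with `g(p) ≠ 0`; two one-nodal forms with the SAME node share `j₀`.
* §3 **`exists_conj_transport_of_node_at`** — if `ω`, `ω'` are pencil circles (radii `ε, ε'`, punctured closed
  discs nonsingular) around one-nodal `M`-forms `f₁, f₁'` with the same node `p`, moved to the base point `t` along
  paths `β, β'`, and `T, T'` are the rational transports of `π_M` (any degree) along `β·ω·β⁻¹`, `β'·ω'·β'⁻¹`, then
  `T' = g T g⁻¹` for some `g` in the monodromy group `Γ_t` (packages IV + F-MC + `IsConj.map` along the inverse chart
  + package III `exists_conj_of_isConj`).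

Sorry-free; axioms `propext`, `Classical.choice`, `Quot.sound`; no definition, no named fact (F-MC and F-DISC-1 are
explicit hypotheses).

## References

* [Shimada2010ZvK] I. Shimada, Lectures on Zariski–van Kampen theorem (arXiv:0906.1074), §3 Prop. 3.4.
* [Deligne1974] P. Deligne, La conjecture de Weil. I, Publ. Math. IHÉS 43 (1974), proof of Thm. (5.4), p. 291.
* [VoisinHodgeII2003] C. Voisin, Hodge Theory and Complex Algebraic Geometry II (CUP 2003), §2.1.1 Cor. 2.8, §3.1.2,
  §3.2.1–3.2.2, §6.2.1.
-/

noncomputable section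

set_option linter.dupNamespace false

open CategoryTheory MvPolynomial Topology
open Literature.AlgebraicTopology.SingularHomology
open Literature.AlgebraicGeometry.Motives Literature.AlgebraicGeometry.Motives.UniversalHypersurface
open Literature.AlgebraicGeometry.HodgeTheory Literature.AlgebraicGeometry.HodgeTheory.UniversalHypersurface
open Literature.AlgebraicGeometry.FundamentalGroup
open Summit.HodgeConjecture.HodgeConjecture.Theorems.SignSymmetricPowersMeridianOneNode
open Summit.HodgeConjecture.HodgeConjecture.Theorems.SignSymmetricPowersMeridianChart
open Summit.HodgeConjecture.HodgeConjecture.Theorems.SignSymmetricPowersMeridianPencil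
open Summit.HodgeConjecture.HodgeConjecture.Theorems.SignSymmetricPowersMeridianMonodromy
open Summit.HodgeConjecture.HodgeConjecture.Theorems.SignSymmetricPowersMeridianSameComponent

namespace Summit.HodgeConjecture.HodgeConjecture.Theorems.SignSymmetricPowersLinkConjugacy

variable (n d : ℕ) (M : Set (DegIndex n d)) [DecidablePred (· ∈ M)]

/-! ### §1 The chart onto the complement of any factor list -/

/-- **The coefficient chart onto the complement of a given hypersurface list**: if `singularCoeffs = V(Disc)` and
`{a ∈ ℂ^M | D_M(a) ≠ 0} = {a | ∀ j, hⱼ(a) ≠ 0}` for SOME list `h` (e.g. the distinct prime factors of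
`D_M = killHom Disc`), then `S_M(ℂ) ≃ₜ affineHypersurfaceComplement h` through `t ↦ (t(a_m))_{m ∈ M}`.
[cite: VoisinHodgeII2003, §6.2.1] [cite: Shimada2010ZvK, §3 Prop. 3.4] -/
theorem exists_homeomorph_of_complement_eq {Disc : MvPolynomial (DegIndex n d) ℂ}
    (hV : ∀ a : DegIndex n d → ℂ, a ∈ singularCoeffs n d ↔ MvPolynomial.eval a Disc = 0)
    {m : ℕ} (h : Fin m → MvPolynomial M ℂ)
    (hcomp : ∀ a : M → ℂ, MvPolynomial.eval a (killHom ℂ n d M Disc) ≠ 0 ↔ a ∈ affineHypersurfaceComplement h) :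
    ∃ e : ComplexPoints (baseM ℂ n d M) ≃ₜ affineHypersurfaceComplement h,
      ∀ t, ((e t : affineHypersurfaceComplement h) : M → ℂ) =
        (coeffVector ℂ n d (AlgPoints.map (toBase ℂ n d M) t)) ∘ (Subtype.val : M → DegIndex n d) := by
  have hrange' : Set.range (fun t : ComplexPoints (baseM ℂ n d M) =>
      (coeffVector ℂ n d (AlgPoints.map (toBase ℂ n d M) t)) ∘ (Subtype.val : M → DegIndex n d)) =
      affineHypersurfaceComplement h := by
    rw [range_coeffChart_eq n d M hV]
    ext a
    exact hcomp a
  exact ⟨(isEmbedding_coeffChart n d M).toHomeomorph.trans (Homeomorph.setCongr hrange'), fun t => rfl⟩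

/-! ### §2 Factorisations with exponents -/

section Factorization

variable {σ : Type}

/-- For `D = w · ∏ⱼ hⱼ^{eⱼ}` with `w` a unit and all `eⱼ ≥ 1`: `D(a) ≠ 0 ↔ ∀ j, hⱼ(a) ≠ 0`. [folklore] -/
theorem eval_ne_zero_iff_of_factorization {m : ℕ} {D w : MvPolynomial σ ℂ} (hw : IsUnit w)
    {h : Fin m → MvPolynomial σ ℂ} {e : Fin m → ℕ} (he : ∀ j, 1 ≤ e j) (hfac : D = w * ∏ j, h j ^ e j)
    (a : σ → ℂ) : MvPolynomial.eval a D ≠ 0 ↔ a ∈ affineHypersurfaceComplement h := by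
  rw [mem_affineHypersurfaceComplement_iff, hfac, map_mul, map_prod, mul_ne_zero_iff, Finset.prod_ne_zero_iff]
  simp only [map_pow, Finset.mem_univ, true_imp_iff]
  have hwne : MvPolynomial.eval a w ≠ 0 := (hw.map (MvPolynomial.eval a)).ne_zero
  constructor
  · rintro ⟨-, hall⟩ j
    exact fun h0 => hall j (by rw [h0, zero_pow (by have := he j; omega)])
  · intro hall
    exact ⟨hwne, fun j => pow_ne_zero _ (hall j)⟩

/-- The list `(hⱼ^{eⱼ})ⱼ` writes `D = w · ∏ⱼ hⱼ^{eⱼ}` in the exponent-free shape of packages I/II/VII. [folklore] -/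
theorem factorization_pow {m : ℕ} {D w : MvPolynomial σ ℂ} {h : Fin m → MvPolynomial σ ℂ} {e : Fin m → ℕ}
    (hfac : D = w * ∏ j, h j ^ e j) : D = w * ∏ j, (fun j => h j ^ e j) j := hfac

/-- Reading the three `Meridian` conditions through the list `(hⱼ^{eⱼ})ⱼ`: if exactly `h_{j₀}^{e_{j₀}}` vanishes at
`a` and `Σ_k ∂_k(h_{j₀}^{e_{j₀}})(a) v_k ≠ 0`, then `e_{j₀} = 1`, exactly `h_{j₀}` vanishes at `a`, and
`Σ_k ∂_k h_{j₀}(a) v_k ≠ 0`. [folklore] -/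
theorem meridianFields_of_pow [Fintype σ] {m : ℕ} {h : Fin m → MvPolynomial σ ℂ} {e : Fin m → ℕ}
    (he : ∀ j, 1 ≤ e j) {a v : σ → ℂ} {j₀ : Fin m}
    (h0 : MvPolynomial.eval a (h j₀ ^ e j₀) = 0)
    (hne : ∀ i, i ≠ j₀ → MvPolynomial.eval a (h i ^ e i) ≠ 0)
    (htr : ∑ k, MvPolynomial.eval a (pderiv k (h j₀ ^ e j₀)) * v k ≠ 0) :
    e j₀ = 1 ∧ MvPolynomial.eval a (h j₀) = 0 ∧ (∀ i, i ≠ j₀ → MvPolynomial.eval a (h i) ≠ 0) ∧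
      ∑ k, MvPolynomial.eval a (pderiv k (h j₀)) * v k ≠ 0 := by
  have h0' : MvPolynomial.eval a (h j₀) = 0 := by
    rw [map_pow] at h0
    exact pow_eq_zero_iff (by have := he j₀; omega) |>.1 h0
  have hne' : ∀ i, i ≠ j₀ → MvPolynomial.eval a (h i) ≠ 0 := fun i hi hi0 =>
    hne i hi (by rw [map_pow, hi0, zero_pow (by have := he i; omega)])
  have he1 : e j₀ = 1 := by
    by_contra hne1
    have h2 : 2 ≤ e j₀ := by have := he j₀; omega
    apply htr
    refine Finset.sum_eq_zero fun k _ => ?_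
    rw [(pderiv k).leibniz_pow, smul_eq_mul, nsmul_eq_mul, map_mul, map_mul, map_pow, h0', zero_pow (by omega),
      zero_mul, mul_zero, zero_mul]
  refine ⟨he1, h0', hne', ?_⟩
  have h1 : h j₀ ^ e j₀ = h j₀ := by rw [he1, pow_one]
  rwa [h1] at htr

end Factorization

/-- **Two one-nodal `M`-forms with the same node lie on the same factor, transversally** — package VII
(`exists_common_factor_of_node_at`) for a factorisation WITH EXPONENTS `D_M = w · ∏ⱼ hⱼ^{eⱼ}` (`w` a unit,
`eⱼ ≥ 1`; the `hⱼ` need not be distinct or irreducible here): one index `j₀` such that `h_{j₀}` is the only listed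
polynomial vanishing at `coeff_M f₁` and at `coeff_M f₁'`, `e_{j₀} = 1`, and both pencil directions are transversal.
GRANTED F-DISC-1. [cite: VoisinHodgeII2003, §2.1.1 Cor. 2.8] [cite: Shimada2010ZvK, §3 Prop. 3.4] -/
theorem exists_common_factor_of_node_at_pow (hB : discriminant_localBranches_nodal)
    {Disc : MvPolynomial (DegIndex n d) ℂ} (hirr : Irreducible Disc)
    (hV : ∀ a : DegIndex n d → ℂ, a ∈ singularCoeffs n d ↔ MvPolynomial.eval a Disc = 0) (hd : 1 ≤ d)
    {m : ℕ} {w : MvPolynomial M ℂ} (hw : IsUnit w) (h : Fin m → MvPolynomial M ℂ) {e : Fin m → ℕ}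
    (he : ∀ j, 1 ≤ e j) (hfac : killHom ℂ n d M Disc = w * ∏ j, h j ^ e j)
    {f₁ g f₁' g' : MvPolynomial (Fin (n + 2)) ℂ} (hf₁ : f₁.IsHomogeneous d) (hg : g.IsHomogeneous d)
    (hf₁' : f₁'.IsHomogeneous d) (hg' : g'.IsHomogeneous d)
    (hM₁ : IsSupportedOn n d M f₁) (hMg : IsSupportedOn n d M g)
    (hM₁' : IsSupportedOn n d M f₁') (hMg' : IsSupportedOn n d M g') {p : Fin (n + 2) → ℂ}
    (hnod : IsNodalFormWithNodes f₁ ![p]) (hnod' : IsNodalFormWithNodes f₁' ![p])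
    (hgp : MvPolynomial.eval p g ≠ 0) (hgp' : MvPolynomial.eval p g' ≠ 0) :
    haveI : Fintype M := Subtype.fintype _
    ∃ j₀, e j₀ = 1 ∧
      (MvPolynomial.eval (fun m' : M => coeff m'.1.1 f₁) (h j₀) = 0 ∧
        (∀ i, i ≠ j₀ → MvPolynomial.eval (fun m' : M => coeff m'.1.1 f₁) (h i) ≠ 0) ∧
        ∑ k, MvPolynomial.eval (fun m' : M => coeff m'.1.1 f₁) (pderiv k (h j₀)) * (fun m' : M => coeff m'.1.1 g) k ≠ 0) ∧
      (MvPolynomial.eval (fun m' : M => coeff m'.1.1 f₁') (h j₀) = 0 ∧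
        (∀ i, i ≠ j₀ → MvPolynomial.eval (fun m' : M => coeff m'.1.1 f₁') (h i) ≠ 0) ∧
        ∑ k, MvPolynomial.eval (fun m' : M => coeff m'.1.1 f₁') (pderiv k (h j₀)) * (fun m' : M => coeff m'.1.1 g') k ≠ 0) := by
  classical
  obtain ⟨j₀, ⟨h0, hne, htr⟩, ⟨h0', hne', htr'⟩⟩ :=
    exists_common_factor_of_node_at n d M hB hirr hV hd hw (fun j => h j ^ e j) (factorization_pow hfac)
      hf₁ hg hf₁' hg' hM₁ hMg hM₁' hMg' hnod hnod' hgp hgp'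
  obtain ⟨he1, h1, h2, h3⟩ := meridianFields_of_pow he h0 hne htr
  obtain ⟨-, h1', h2', h3'⟩ := meridianFields_of_pow he h0' hne' htr'
  exact ⟨j₀, he1, ⟨h1, h2, h3⟩, ⟨h1', h2', h3'⟩⟩

/-! ### §3 Conjugate transports -/

/-- **Pencil circles around one-nodal members with the same node have `Γ`-conjugate transports.**  Setting of the
module docstring (`D_M = w · ∏ⱼ hⱼ^{eⱼ}`, `w` a unit, `hⱼ` irreducible, `eⱼ ≥ 1`; F-MC and F-DISC-1 granted).  Let
`f₁, f₁'` be `M`-supported forms of degree `d` with exactly one node, at the same point `p`, `g, g'` `M`-supported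
co-pencil forms with `g(p), g'(p) ≠ 0`, `ε, ε' > 0` radii whose punctured closed pencil discs are nonsingular,
`β : t ⇝ s`, `β' : t ⇝ s'` paths in `S_M(ℂ)` to the points of `f₁ + ε g`, `f₁' + ε' g'`, and `ω, ω'` the pencil
circles there.  If `T, T'` are the rational transports of `π_M` (degree `k`) along `β·ω·β⁻¹` and `β'·ω'·β'⁻¹`, then
`T' = γ T γ⁻¹` for some `γ` in the monodromy group at `t`.  Proof: both loops are, through the coefficient chart,
loops of `Meridian`s of the same component `V(h_{j₀})` (packages I/VII/IV); F-MC makes their classes conjugate in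
`π₁` of the complement; push the conjugacy back along the inverse chart (`IsConj.map`) and read it on transports
(package III). [cite: Shimada2010ZvK, §3 Prop. 3.4] [cite: Deligne1974, proof of Thm. (5.4), p. 291]
[cite: VoisinHodgeII2003, §3.1.2 and §3.2.2] -/
theorem exists_conj_transport_of_node_at (hMC : affineHypersurfaceComplement_meridian_isConj)
    (hB : discriminant_localBranches_nodal)
    {Disc : MvPolynomial (DegIndex n d) ℂ} (hirr : Irreducible Disc)
    (hV : ∀ a : DegIndex n d → ℂ, a ∈ singularCoeffs n d ↔ MvPolynomial.eval a Disc = 0) (hn : 1 ≤ n) (hd : 1 ≤ d)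
    {m : ℕ} {w : MvPolynomial M ℂ} (hw : IsUnit w) {h : Fin m → MvPolynomial M ℂ} (hirrh : ∀ j, Irreducible (h j))
    {e : Fin m → ℕ} (he : ∀ j, 1 ≤ e j) (hfac : killHom ℂ n d M Disc = w * ∏ j, h j ^ e j)
    (hU : IsCohomologicallyLocallyTrivialOn (familyM ℂ n d M) Set.univ)
    {f₁ g f₁' g' : MvPolynomial (Fin (n + 2)) ℂ} (hf₁ : f₁.IsHomogeneous d) (hg : g.IsHomogeneous d)
    (hf₁' : f₁'.IsHomogeneous d) (hg' : g'.IsHomogeneous d)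
    (hM₁ : IsSupportedOn n d M f₁) (hMg : IsSupportedOn n d M g)
    (hM₁' : IsSupportedOn n d M f₁') (hMg' : IsSupportedOn n d M g') {p : Fin (n + 2) → ℂ}
    (hnod : IsNodalFormWithNodes f₁ ![p]) (hnod' : IsNodalFormWithNodes f₁' ![p])
    (hgp : MvPolynomial.eval p g ≠ 0) (hgp' : MvPolynomial.eval p g' ≠ 0)
    {ε ε' : ℝ} (hε : 0 < ε) (hε' : 0 < ε')
    (hns : ∀ c : ℂ, c ≠ 0 → ‖c‖ ≤ ε → SmoothHypersurface.IsNonsingularForm ℂ (f₁ + c • g))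
    (hns' : ∀ c : ℂ, c ≠ 0 → ‖c‖ ≤ ε' → SmoothHypersurface.IsNonsingularForm ℂ (f₁' + c • g'))
    {t s s' : ComplexPoints (baseM ℂ n d M)}
    (β : Path t s) (hs : pointFormM ℂ n d M s = f₁ + ((ε : ℝ) : ℂ) • g) (ω : Path s s)
    (hω : IsPencilCircle n d f₁ g ε (ω.map (AlgPoints.mapContinuous (toBase ℂ n d M)).continuous))
    (β' : Path t s') (hs' : pointFormM ℂ n d M s' = f₁' + ((ε' : ℝ) : ℂ) • g') (ω' : Path s' s')
    (hω' : IsPencilCircle n d f₁' g' ε' (ω'.map (AlgPoints.mapContinuous (toBase ℂ n d M)).continuous))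
    {k : ℕ}
    {T T' : bettiCohomology (fiberOver (familyM ℂ n d M) t) k ≃ₗ[ℚ] bettiCohomology (fiberOver (familyM ℂ n d M) t) k}
    (hT : IsRatTransport (familyM ℂ n d M) k hU ⟦((β.trans ω).trans β.symm).map
      (⟨fun s => ⟨s, Set.mem_univ s⟩, continuous_id.subtype_mk _⟩ :
        C(ComplexPoints (baseM ℂ n d M), (Set.univ : Set (ComplexPoints (baseM ℂ n d M))))).continuous⟧ T)
    (hT' : IsRatTransport (familyM ℂ n d M) k hU ⟦((β'.trans ω').trans β'.symm).map
      (⟨fun s => ⟨s, Set.mem_univ s⟩, continuous_id.subtype_mk _⟩ :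
        C(ComplexPoints (baseM ℂ n d M), (Set.univ : Set (ComplexPoints (baseM ℂ n d M))))).continuous⟧ T') :
    ∃ γ ∈ ratMonodromyGroup (familyM ℂ n d M) k hU ⟨t, Set.mem_univ t⟩, T' = γ * T * γ⁻¹ := by
  classical
  -- the chart onto the complement of the listed factors
  obtain ⟨eH, heH⟩ := exists_homeomorph_of_complement_eq n d M hV h (eval_ne_zero_iff_of_factorization hw he hfac)
  -- one factor through both centres, with the `Meridian` fields
  obtain ⟨j₀, -, ⟨h0, hne, htr⟩, ⟨h0', hne', htr'⟩⟩ := exists_common_factor_of_node_at_pow n d M hB hirr hV hd hw h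
    he hfac hf₁ hg hf₁' hg' hM₁ hMg hM₁' hMg' hnod hnod' hgp hgp'
  -- the two pencil loops are loops of meridians of `V(h_{j₀})`
  obtain ⟨μ, -, -, -, hμ⟩ := exists_meridian_of_pencilCircle n d M eH heH hf₁ hg hM₁ hMg h0 hne htr hε hns β hs ω hω
  obtain ⟨μ', -, -, -, hμ'⟩ :=
    exists_meridian_of_pencilCircle n d M eH heH hf₁' hg' hM₁' hMg' h0' hne' htr' hε' hns' β' hs' ω' hω'
  -- F-MC, pushed back to `S_M(ℂ)` along the inverse chart
  have hconj : IsConj μ.loopClass μ'.loopClass := hMC M m h hirrh (eH t) j₀ μ μ'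
  have hconj' := (FundamentalGroup.mapOfEq
    (⟨fun z => ⟨eH.symm z, Set.mem_univ _⟩, (continuous_id.subtype_mk _).comp eH.symm.continuous⟩ :
      C(affineHypersurfaceComplement h, (Set.univ : Set (ComplexPoints (baseM ℂ n d M)))))
    (show (⟨eH.symm (eH t), Set.mem_univ _⟩ : (Set.univ : Set (ComplexPoints (baseM ℂ n d M)))) =
      ⟨t, Set.mem_univ t⟩ from Subtype.ext (eH.symm_apply_apply t))).map_isConj hconj
  have hc : IsConj
      (FundamentalGroup.fromPath (Path.Homotopic.Quotient.mk (((β.trans ω).trans β.symm).map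
        (⟨fun s => ⟨s, Set.mem_univ s⟩, continuous_id.subtype_mk _⟩ :
          C(ComplexPoints (baseM ℂ n d M), (Set.univ : Set (ComplexPoints (baseM ℂ n d M))))).continuous)))
      (FundamentalGroup.fromPath (Path.Homotopic.Quotient.mk (((β'.trans ω').trans β'.symm).map
        (⟨fun s => ⟨s, Set.mem_univ s⟩, continuous_id.subtype_mk _⟩ :
          C(ComplexPoints (baseM ℂ n d M), (Set.univ : Set (ComplexPoints (baseM ℂ n d M))))).continuous))) := by
    convert hconj' using 1
    · exact hμ.symm
    · exact hμ'.symm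
  -- read the conjugacy on the transports
  exact exists_conj_of_isConj (familyM ℂ n d M) k hU
    (fun _ _ δ' _ hα => isRationalClass_transportFun_familyM n d M hn hd k hU δ' hα) ⟨t, Set.mem_univ t⟩ hc hT hT'

end Summit.HodgeConjecture.HodgeConjecture.Theorems.SignSymmetricPowersLinkConjugacy

end
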